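/-
Copyright: the b2b-balaban cell (near-miss cell 7), T⁴-continuum CRUX team (coordinator ruling e34b3e0c item (2)),
lineage t4-ne7b-formalise-leaf-04 (gen 24). Released under the licence of the surrounding project.
-/
import Summits.QuantumFields.BalabanUV.T4Continuum.Spine.NE7b.HealingMapCarrier

/-!
# H2 IN PRODUCT FORM: step-wise domination of positive operations composes multiplicatively along the inductive
# representation (route R-H of `t4/ROUTES-NE7b.md` v4, step H2 «SUP-QUOTIENT BY POSITIVITY [K + P-form] … the gen-2
# `term_le_of_quotient` generalised to a product of steps»; sibling of `…NE7b.HealingMap` ∕ `…HealingMapCarrier`)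

Cell `pub-balaban`, sub-cell `t4`, spine estimate NE7b (node U5c), candidate route R-H «Peierls healing map», v4 text of
H2: «if at every step `n` of the comparison the step-`n` integrand of `H` is `≤ (factor_n) ×` the step-`n` integrand of
`H ∖ C` AS POSITIVE OPERATORS APPLIED TO POSITIVE FUNCTIONS, then `A(H) ≤ (Π_n factor_n)·A(H ∖ C)`».  In the operator
language of the lineage's carrier M1 (`B16RelPosOp`: `RelLinPosOp 𝒢`, the composite `piR` of a list of operations —
the shape in which (1.72)'s nested operations and the inductive representation's steps are typed), this is the
following kernel statement, proved here ([folklore]; zero `sorry`; nothing of Bałaban's asserted):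

* `RelLinPosOp.piR_good`, `RelLinPosOp.piR_nonneg` — a composite of relative operations preserves the good class and
  non-negativity on it;
* **`RelLinPosOp.piR_le_prod_mul_piR`** — STEP-WISE DOMINATION COMPOSES: if for every step label `d` the bad branch's
  operation `P d` is dominated by `f d ×` the healed branch's operation `Q d` on non-negative good functions
  (`(P d).T F ≤ f d · (Q d).T F`, `f d ≥ 0` — the RELATIVE reading, per step, of a printed absolute bound: H3-birth ∕
  H3-step ∕ H3-renew; steps common to both branches enter with `P d = Q d`, `f d = 1`, `le_one_mul_self`), then for every
  non-negative good seed `F` and every list of steps `l`,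
  `(piR P l).T F ≤ (l.map f).prod · (piR Q l).T F` pointwise — monotonicity (`mono`) and homogeneity (`smul`) of the
  healed branch's operations push each step's factor out, exactly as (1.73)–(1.75) p. 380 of [Balaban1989LargeFieldII]
  push constants through `𝕋′` (there: complex vs real argument of ONE operator; here: the two BRANCHES, route text);
* **`RelLinPosOp.integral_piR_le_prod_mul`** — integrated against any measure (the final unit-lattice field): the bad
  branch's weight is at most `(Π factor)` times the healed branch's weight — the hypothesis `le_heal` of
  `NE7b.HealingMap.HealingLaws` ∕ the `hle` of `Repr172R.weight_le_mul_weight` in PRODUCT FORM, via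
  `NE7b.HealingMap.integral_le_mul_integral_of_le`.

NOT HERE (honest): that Bałaban's step operations for the two branches ARE so dominated, with WHICH factors (H3's three
relative readings + PH-c⁺, PRICING-NE7b v3 F13–F15) — displayed hypotheses `hdom`, `hf`.  BY-NAME EFFECT ON THE WALL
(`WALL-NE7b-P1.md` §2): NONE.  NE7b NOT PRINTED, NOT PROVED; spine PROVED 0∕9; rung (B)+1 on a FINITE torus T⁴ — NOT
infinite volume, NOT the mass gap, NOT Clay.  POLICY (ruling e34b3e0c): crux-route work of item (2) named in
ROUTES-NE7b v4 §2 H2; NOT a `T4Continuum/Support` leaf; no definition, no fact minted.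
HONEST DEPENDENCY: continuum YM on T⁴ ⇐ BetaPertH ∧ nine spine estimates (0/9 proved); BetaPertH ⇐ (D1) ∧ (D4) ∧
CAP+tail; G-an2-4 gates asym, D1 and NE2/3/4.  This file changes none of it.
-/

set_option autoImplicit false

open MeasureTheory

namespace Summit.QuantumFields.BalabanUV.T4Continuum.B16HistoryIndexedRepr

namespace RelLinPosOp

variable {C : Type*} {𝒢 : GoodClass C} {δ : Type*}

/-- A composite of relative operations preserves the good class. [folklore] -/
theorem piR_good (ops : δ → RelLinPosOp 𝒢) {F : C → ℝ} (hF : 𝒢.Gd F) :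
    ∀ l : List δ, 𝒢.Gd ((piR ops l).T F)
  | [] => hF
  | d :: l => (ops d).map_good (piR_good ops hF l)

/-- A composite of relative operations maps non-negative good functions to non-negative functions. [folklore] -/
theorem piR_nonneg (ops : δ → RelLinPosOp 𝒢) {F : C → ℝ} (hF : 𝒢.Gd F) (hF0 : ∀ y, 0 ≤ F y) :
    ∀ (l : List δ) (x : C), 0 ≤ (piR ops l).T F x
  | [], x => hF0 x
  | d :: l, x => (ops d).apply_nonneg (piR_good ops hF l) (fun y => piR_nonneg ops hF hF0 l y) x

/-- Every operation is dominated by itself with factor one (the steps COMMON to both branches). [folklore] -/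
theorem le_one_mul_self (P : RelLinPosOp 𝒢) (F : C → ℝ) (x : C) : P.T F x ≤ 1 * P.T F x := by
  rw [one_mul]

/-- **STEP-WISE DOMINATION COMPOSES MULTIPLICATIVELY** (route R-H, H2 in product form).  If for every step label `d`
the operation `P d` is dominated on non-negative good functions by `f d ×` the operation `Q d`, with `f d ≥ 0`, then
for every non-negative good seed `F` and every list of steps `l`,
`(P_{d₁} ∘ ⋯ ∘ P_{d_n}) F ≤ (Π_i f_{d_i}) · (Q_{d₁} ∘ ⋯ ∘ Q_{d_n}) F` pointwise. [folklore] -/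
theorem piR_le_prod_mul_piR (P Q : δ → RelLinPosOp 𝒢) (f : δ → ℝ) (hf : ∀ d, 0 ≤ f d)
    (hdom : ∀ d (F : C → ℝ), 𝒢.Gd F → (∀ y, 0 ≤ F y) → ∀ x, (P d).T F x ≤ f d * (Q d).T F x)
    {F : C → ℝ} (hF : 𝒢.Gd F) (hF0 : ∀ y, 0 ≤ F y) :
    ∀ (l : List δ) (x : C), (piR P l).T F x ≤ (l.map f).prod * (piR Q l).T F x
  | [], x => by
      show F x ≤ (([] : List δ).map f).prod * F x
      simp
  | d :: l, x => by
      have hprod : 0 ≤ (l.map f).prod :=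
        List.prod_nonneg fun a ha => by
          obtain ⟨d', -, rfl⟩ := List.mem_map.mp ha
          exact hf d'
      -- the inner composites: `A` (bad branch), `B` (healed branch), `A ≤ (Π f)·B`, both good, `A ≥ 0`
      have hA : 𝒢.Gd ((piR P l).T F) := piR_good P hF l
      have hB : 𝒢.Gd ((piR Q l).T F) := piR_good Q hF l
      have hA0 : ∀ y, 0 ≤ (piR P l).T F y := piR_nonneg P hF hF0 l
      have hAB : ∀ y, (piR P l).T F y ≤ (l.map f).prod * (piR Q l).T F y := piR_le_prod_mul_piR P Q f hf hdom hF hF0 l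
      show (P d).T ((piR P l).T F) x ≤ ((d :: l).map f).prod * (Q d).T ((piR Q l).T F) x
      rw [List.map_cons, List.prod_cons]
      calc (P d).T ((piR P l).T F) x ≤ f d * (Q d).T ((piR P l).T F) x := hdom d _ hA hA0 x
        _ ≤ f d * ((l.map f).prod * (Q d).T ((piR Q l).T F) x) :=
            mul_le_mul_of_nonneg_left ((Q d).apply_le_mul_apply_of_le hA hB hAB x) (hf d)
        _ = f d * (l.map f).prod * (Q d).T ((piR Q l).T F) x := by ring

/-- **H2 IN PRODUCT FORM, INTEGRATED**: under step-wise domination, the bad branch's weight (the integral of its final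
density against the final field's measure) is at most `(Π factor)` times the healed branch's weight — the `le_heal` of
`NE7b.HealingMap.HealingLaws` for terms built by the two composites from a common non-negative good seed. [folklore] -/
theorem integral_piR_le_prod_mul [MeasurableSpace C] (μ : Measure C) (P Q : δ → RelLinPosOp 𝒢) (f : δ → ℝ)
    (hf : ∀ d, 0 ≤ f d)
    (hdom : ∀ d (F : C → ℝ), 𝒢.Gd F → (∀ y, 0 ≤ F y) → ∀ x, (P d).T F x ≤ f d * (Q d).T F x)
    {F : C → ℝ} (hF : 𝒢.Gd F) (hF0 : ∀ y, 0 ≤ F y) (l : List δ) (hint : Integrable ((piR Q l).T F) μ) :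
    ∫ x, (piR P l).T F x ∂μ ≤ (l.map f).prod * ∫ x, (piR Q l).T F x ∂μ :=
  NE7b.HealingMap.integral_le_mul_integral_of_le
    (Filter.Eventually.of_forall fun x => piR_nonneg P hF hF0 l x) hint
    (Filter.Eventually.of_forall fun x => piR_le_prod_mul_piR P Q f hf hdom hF hF0 l x)

end RelLinPosOp

end Summit.QuantumFields.BalabanUV.T4Continuum.B16HistoryIndexedRepr
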